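import Summits.Ventures.LatticeQCDFlow.Scaling.SwapGraphRateLaw

/-!
HONEST FRAMING: exact (Metropolis-corrected) sampling algorithms for lattice gauge theory; figures
of merit are autocorrelation/cost numbers at stated couplings and volumes; no continuum-physics
claim.

# ExchangeCostLaw — COST ACCOUNTING FOR THE HOT-ONLY EXCHANGE SCHEME: IF A SWAP STEP COSTS `κ_s` AND A HOT UPDATE
# `κ_u`, THEN FOR EVERY SWAP FRACTION `t` THE COST OF ONE RELAXATION TIME IS AT LEAST `κ_s/a + κ_u/b` (SWAP COST OVER
# SWAP THROUGHPUT PLUS UPDATE COST OVER TUNNELLING THROUGHPUT — THE TWO COSTS ADD, THEY DO NOT TRADE), AND THE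
# BALANCED FRACTION BRINGS IT BELOW `(κ_s/a′ + κ_u/b′)/p` (lean-2 GEN-23, ours)

Venture-side (OURS).  Cell `lqcd-flow` (pub-lqcd), unit `pub-lqcd-lean-2-g23`, 2026-08-26.  Chapter K, file 5: the
cell's figure of merit is relaxation PER COST, and the two moves of an exchange scheme have different prices (a swap is
an acceptance test on stored energies; a hot update is a sweep, or a flow evaluation).  Setting of
`Scaling/SwapGraphRateLaw` (K3): the hot-only scheme `P_t = t·ptGraphSwap μ e 1 + (1−t)·prodKernel 𝟙_{k=0} M` on an edge
list of `m` entries (`h` at the hot level, every hub edge `≥ c` times), one-sided domination `p`, hot Poincaré constant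
`γ₀`, a set `A` with `μ_k(A)μ_k(Aᶜ) ≥ v`; throughputs `a = h·min{μ_0(A),μ_0(Aᶜ)}/(mKv)`, `b = Q_0(A,Aᶜ)/((K+1)v)`
(ceiling side) and `a′ = c/(6m)`, `b′ = γ₀/(14K)` (floor side).  The mean cost of a step of `P_t` is
`tκ_s + (1−t)κ_u`; the cost of a relaxation time is `(tκ_s + (1−t)κ_u)/Gap(P_t)`.

## What is proved

* §1 real lemmas: `min_mul_cost_le` (`min{ta,(1−t)b}·(κ_s/a + κ_u/b) ≤ tκ_s + (1−t)κ_u`), `harmonic_mul_cost_eq`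
  (`(ab/(a+b))·(κ_s/a + κ_u/b) = t⋆κ_s + (1−t⋆)κ_u` at `t⋆ = b/(a+b)`).
* §2 **`hotOnlyGraph_gap_mul_cost_le` (THE COST FLOOR OF A RELAXATION):** for EVERY `0 ≤ t ≤ 1` and `κ_s, κ_u ≥ 0`,
  `Gap(P_t)·(κ_s/a + κ_u/b) ≤ tκ_s + (1−t)κ_u` — one relaxation time costs at least `κ_s/a + κ_u/b`, whatever the
  split between swapping and updating.
* §3 **`hotOnlyGraph_cost_le_gap_mul` (THE BALANCED FRACTION):** at `t⋆ = b′/(a′+b′)`,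
  `p·(t⋆κ_s + (1−t⋆)κ_u) ≤ Gap(P_{t⋆})·(κ_s/a′ + κ_u/b′)` — one relaxation time costs at most `(κ_s/a′ + κ_u/b′)/p`.

Reading (no numerics implied): for the uniform hub (`c = 1`, `m = h = K`) a relaxation costs between
`K·v·κ_s/min{μ_0(A),μ_0(Aᶜ)} + (K+1)·v·κ_u/Q_0(A,Aᶜ)` and `(6K·κ_s + 14K·κ_u/γ₀)/p`: order `K` swaps AND order `K/γ₀`
hot updates, additively — a cheaper or dearer hot sampler moves only its own term, and no retuning of the swap
fraction converts one budget into the other.  NOT CLAIMED: amortised training costs of a learned hot sampler (a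
constant added to `κ_u` per use only under a stated amortisation schedule); parallel execution of swaps; anything
measured.  Literature grade (cell rule): OWN COMPOSITION (K3 + arithmetic); nothing cited as a fact; no new bib keys.
-/

noncomputable section

open Finset Function
open Literature.Probability.MarkovChains

namespace Summit.Ventures.LatticeQCDFlow.Scaling

/-! ## §1 Two real lemmas -/

/-- **`min{t·a, (1−t)·b}·(κ_s/a + κ_u/b) ≤ t·κ_s + (1−t)·κ_u`** for `a, b > 0`, `κ_s, κ_u ≥ 0` (any real `t`): each
cost is paid at its own throughput. [ours] -/
theorem min_mul_cost_le {a b κs κu t : ℝ} (ha : 0 < a) (hb : 0 < b) (hκs : 0 ≤ κs) (hκu : 0 ≤ κu) :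
    min (t * a) ((1 - t) * b) * (κs / a + κu / b) ≤ t * κs + (1 - t) * κu := by
  have h1 : min (t * a) ((1 - t) * b) * (κs / a) ≤ t * κs :=
    calc min (t * a) ((1 - t) * b) * (κs / a) ≤ t * a * (κs / a) :=
          mul_le_mul_of_nonneg_right (min_le_left _ _) (div_nonneg hκs ha.le)
      _ = t * κs := by field_simp
  have h2 : min (t * a) ((1 - t) * b) * (κu / b) ≤ (1 - t) * κu :=
    calc min (t * a) ((1 - t) * b) * (κu / b) ≤ (1 - t) * b * (κu / b) :=
          mul_le_mul_of_nonneg_right (min_le_right _ _) (div_nonneg hκu hb.le)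
      _ = (1 - t) * κu := by field_simp
  rw [mul_add]
  exact add_le_add h1 h2

/-- **At the balanced fraction `t⋆ = b/(a+b)` the harmonic rate pays exactly the mean step cost:**
`(ab/(a+b))·(κ_s/a + κ_u/b) = t⋆κ_s + (1−t⋆)κ_u`. [ours] -/
theorem harmonic_mul_cost_eq {a b : ℝ} (ha : 0 < a) (hb : 0 < b) (κs κu : ℝ) :
    a * b / (a + b) * (κs / a + κu / b) = b / (a + b) * κs + (1 - b / (a + b)) * κu := by
  have hab : a + b ≠ 0 := (add_pos ha hb).ne'
  field_simp
  ring

variable {S : Type*} [Fintype S] [DecidableEq S] {K m : ℕ} {μ : Fin (K + 1) → S → ℝ}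
  {M : Fin (K + 1) → S → S → ℝ} {t : ℝ} {e : Fin m → Fin (K + 1) × Fin (K + 1)}

/-! ## §2 The cost floor of a relaxation, for every swap fraction -/

/-- **THE COST OF A RELAXATION TIME IS AT LEAST `κ_s/a + κ_u/b`:** hot-only updates, identity maps, any edge list with
`h ≥ 1` entries at the hot level, `μ_0(A), μ_0(Aᶜ), Q_0(A,Aᶜ) > 0`, `μ_k(A)μ_k(Aᶜ) ≥ v > 0` for all `k`, costs
`κ_s, κ_u ≥ 0`; for EVERY `0 ≤ t ≤ 1`:
**`Gap(P_t)·(κ_s/a + κ_u/b) ≤ t·κ_s + (1−t)·κ_u`**, `a = h·min{μ_0(A),μ_0(Aᶜ)}/(mKv)`, `b = Q_0(A,Aᶜ)/((K+1)v)`. [ours] -/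
theorem hotOnlyGraph_gap_mul_cost_le [Nontrivial S] (hK : 1 ≤ K) (hm : 1 ≤ m) (he : ∀ r, (e r).1 ≠ (e r).2)
    (hh : 1 ≤ (univ.filter fun r : Fin m => (e r).1 = 0 ∨ (e r).2 = 0).card) (hμ : ∀ k x, 0 < μ k x)
    (hμ1 : ∀ k, ∑ u, μ k u = 1) (hM : ∀ k, IsRowStochastic (M k)) (hMrev : ∀ k, DetailedBalance (μ k) (M k))
    (ht0 : 0 ≤ t) (ht1 : t ≤ 1) {A : Finset S} (hA0 : 0 < min (∑ u ∈ A, μ 0 u) (∑ u ∈ Aᶜ, μ 0 u))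
    (hQ0 : 0 < edgeMeasure (μ 0) (M 0) A Aᶜ) {v : ℝ} (hvpos : 0 < v)
    (hv : ∀ k : Fin (K + 1), v ≤ (∑ u ∈ A, μ k u) * ∑ u ∈ Aᶜ, μ k u) {κs κu : ℝ} (hκs : 0 ≤ κs) (hκu : 0 ≤ κu) :
    spectralGap (tensorFun μ) (fun x y : Fin (K + 1) → S =>
        t * ptGraphSwap μ e (fun _ : Fin m => Equiv.refl S) x y
          + (1 - t) * prodKernel (fun k : Fin (K + 1) => if k = 0 then (1 : ℝ) else 0) M x y)
        * (κs / (((univ.filter fun r : Fin m => (e r).1 = 0 ∨ (e r).2 = 0).card : ℝ)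
              * min (∑ u ∈ A, μ 0 u) (∑ u ∈ Aᶜ, μ 0 u) / (m * K * v))
            + κu / (edgeMeasure (μ 0) (M 0) A Aᶜ / (((K : ℝ) + 1) * v)))
      ≤ t * κs + (1 - t) * κu := by
  have hKpos : (0 : ℝ) < K := Nat.cast_pos.mpr (by omega)
  have hmpos : (0 : ℝ) < m := Nat.cast_pos.mpr (by omega)
  have hhpos : (0 : ℝ) < ((univ.filter fun r : Fin m => (e r).1 = 0 ∨ (e r).2 = 0).card : ℝ) := by exact_mod_cast hh
  have hw0 : ∀ k : Fin (K + 1), 0 ≤ (if k = 0 then (1 : ℝ) else 0) := fun k => by positivity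
  have hidle : ∀ k : Fin (K + 1), k ≠ 0 → (if k = 0 then (1 : ℝ) else 0) * edgeMeasure (μ k) (M k) A Aᶜ = 0 :=
    fun k hk => by rw [if_neg hk, zero_mul]
  set a := ((univ.filter fun r : Fin m => (e r).1 = 0 ∨ (e r).2 = 0).card : ℝ) * min (∑ u ∈ A, μ 0 u) (∑ u ∈ Aᶜ, μ 0 u)
    / (m * K * v) with ha_def
  set b := edgeMeasure (μ 0) (M 0) A Aᶜ / (((K : ℝ) + 1) * v) with hb_def
  have ha : 0 < a := by positivity
  have hb : 0 < b := by positivity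
  set G := spectralGap (tensorFun μ) (fun x y : Fin (K + 1) → S =>
      t * ptGraphSwap μ e (fun _ : Fin m => Equiv.refl S) x y
        + (1 - t) * prodKernel (fun k : Fin (K + 1) => if k = 0 then (1 : ℝ) else 0) M x y) with hG
  have h1 := dilutedHandover_spectralGap_le (φ := fun _ : Fin m => Equiv.refl S) hK hm he hμ hμ1 hM hMrev hw0
    hotOnlyWeight_sum ht0 ht1 (fun _ _ => Iff.rfl) hvpos (fun k _ => hv k) hidle
  have h2 := hotOnlyGraph_spectralGap_le_tunneling (e := e) he hμ hμ1 hM hMrev ht0 ht1 hvpos hv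
  have h1' : G ≤ t * a := by rw [hG, ha_def]; convert h1 using 1; ring
  have h2' : G ≤ (1 - t) * b := by rw [hG, hb_def]; convert h2 using 1; ring
  have hGle : G ≤ min (t * a) ((1 - t) * b) := le_min h1' h2'
  have hcost : 0 ≤ κs / a + κu / b := by positivity
  calc G * (κs / a + κu / b) ≤ min (t * a) ((1 - t) * b) * (κs / a + κu / b) :=
        mul_le_mul_of_nonneg_right hGle hcost
    _ ≤ t * κs + (1 - t) * κu := min_mul_cost_le ha hb hκs hκu

/-! ## §3 The balanced fraction pays at most `(κ_s/a′ + κ_u/b′)/p` -/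

/-- **AT THE BALANCED FRACTION ONE RELAXATION TIME COSTS AT MOST `(κ_s/a′ + κ_u/b′)/p`:** with `a′ = c/(6m)`,
`b′ = γ₀/(14K)` and `t⋆ = b′/(a′+b′)` (every hub edge listed `≥ c ≥ 1` times, identity maps, one-sided domination
`p·μ_{k+1} ≤ μ_0`, hot Poincaré constant `γ₀`): **`p·(t⋆κ_s + (1−t⋆)κ_u) ≤ Gap(P_{t⋆})·(κ_s/a′ + κ_u/b′)`**. [ours] -/
theorem hotOnlyGraph_cost_le_gap_mul [Nontrivial S] (hK : 1 ≤ K) (hm : 1 ≤ m) (he : ∀ r, (e r).1 ≠ (e r).2) {c : ℕ}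
    (hc : ∀ k : Fin K, c ≤ (univ.filter (fun r : Fin m => e r = ((0 : Fin (K + 1)), k.succ))).card) (hc1 : 1 ≤ c)
    (hμ : ∀ k x, 0 < μ k x) (hμ1 : ∀ k, ∑ u, μ k u = 1) (hM : ∀ k, IsRowStochastic (M k))
    (hMrev : ∀ k, DetailedBalance (μ k) (M k)) {p γ₀ : ℝ} (hp : 0 < p) (hp1 : p ≤ 1) (hγ₀ : 0 < γ₀)
    (hdom : ∀ (k : Fin K) (u : S), p * μ k.succ u ≤ μ 0 u)
    (hgap0 : ∀ g : S → ℝ, γ₀ * lawVariance (μ 0) g ≤ dirichletForm (μ 0) (M 0) g) {κs κu : ℝ} (hκs : 0 ≤ κs)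
    (hκu : 0 ≤ κu) :
    p * ((γ₀ / (14 * K)) / (c / (6 * m) + γ₀ / (14 * K)) * κs
          + (1 - (γ₀ / (14 * K)) / (c / (6 * m) + γ₀ / (14 * K))) * κu)
      ≤ spectralGap (tensorFun μ) (fun x y : Fin (K + 1) → S =>
          (γ₀ / (14 * K)) / (c / (6 * m) + γ₀ / (14 * K)) * ptGraphSwap μ e (fun _ : Fin m => Equiv.refl S) x y
            + (1 - (γ₀ / (14 * K)) / (c / (6 * m) + γ₀ / (14 * K)))
              * prodKernel (fun k : Fin (K + 1) => if k = 0 then (1 : ℝ) else 0) M x y)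
        * (κs / (c / (6 * m)) + κu / (γ₀ / (14 * K))) := by
  have hKpos : (0 : ℝ) < K := Nat.cast_pos.mpr (by omega)
  have hmpos : (0 : ℝ) < m := Nat.cast_pos.mpr (by omega)
  have hcpos : (0 : ℝ) < c := Nat.cast_pos.mpr (by omega)
  have hfloor := hotOnlyGraph_spectralGap_ge_balanced (M := M) hK hm he hc hc1 hμ hμ1 hM hMrev hp hp1 hγ₀
    hdom hgap0
  set a' : ℝ := c / (6 * m) with ha'
  set b' : ℝ := γ₀ / (14 * K) with hb'
  have ha'pos : 0 < a' := by positivity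
  have hb'pos : 0 < b' := by positivity
  have hcost : 0 ≤ κs / a' + κu / b' := by positivity
  calc p * (b' / (a' + b') * κs + (1 - b' / (a' + b')) * κu)
      = p * (a' * b' / (a' + b')) * (κs / a' + κu / b') := by
        rw [← harmonic_mul_cost_eq ha'pos hb'pos κs κu]; ring
    _ ≤ _ := mul_le_mul_of_nonneg_right hfloor hcost

end Summit.Ventures.LatticeQCDFlow.Scaling

end
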